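/-
Copyright (c) 2026 the pub-hodgecm-mathlib formalisation cell (harness21).  Prover seat hodgecm-mathlib-K2E3-p14 (g10) (E3 hand on strike line L1; LEAD F0P6-plan (g15)
BATCH #198 (a) «(F-arch)» follow-on, default offer 01:05:32Z), Track B «K2-LIT» ∕ hLiu418 = `stmt-HodgeConjecture-24832`: U1-glob LEVEL 2-fin, the ARCH-KERNEL branch —
(F-tail-arch) FILE 1: ★ G1's Euler head with the ARCHIMEDEAN SLOT isolated (the arch twin of ★ B2b FILE 2 p862998 `K2LiuSingularWhittakerPlaceFactorEuler`).  THEOREMS ONLY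
(no `def` ∕ `instance` ∕ notation ∕ named-fact hypothesis ∕ `sorry`).
-/
import Summits.HodgeConjecture.HodgeConjecture.Theorems.K2LiuWhittakerDeltaEulerProduct      -- ★ G1 (K2Liu-p12): `whittakerDelta_eq_mul_tprod_euler`
import Summits.HodgeConjecture.HodgeConjecture.Theorems.K2LiuLocalKernelArchPlaceFactor       -- ★ B5 p863132 (LH4-p10): `integral_prod_pi_eq_mul_of_pureArch`
import HarnessLib

/-!
# Crux `HLiu418`, U1-glob LEVEL 2-fin, arch-kernel branch — (F-tail-arch) FILE 1: ★ G1's EULER HEAD WITH THE ARCHIMEDEAN SLOT ISOLATED —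
# `W_S(f_s)(h) = A_∞(s, h) · (HEAD_T^{fin}(s, h) · ∏'_{v∉T} W°_{S,v}(s))` for a head family pure in the arch slot   [KudlaRallis1994 §2; Tan1999 §3]

Cell `hodgecm-mathlib`, crux item hLiu418 = `stmt-HodgeConjecture-24832`; squad K2, strike line L1, LEAD F0P6-plan (g15); U1 desk K2E3-p28 (g3); END pen K2E3-p32 (g3);
prover K2E3-p14 (g10).  Lane `--supports stmt-HodgeConjecture-24832 --as helper` (count-neutral).  THEOREMS ONLY.

THE POINT ((F-arch) ★ p863937's by-value letter `htail∞`, first link).  At an ARCHIMEDEAN kernel place U1-glob LEVEL 2's corner package takes `Fn :=` the continued ARCH BLOCK of the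
corner-twisted singular term and `Rst :=` the FINITE head × `sc¹^{↑T}` × shell factors (★ `K2LiuLocalKernelPlacePackageArch.archCornerPackage_cm`).  ★ G1
`K2LiuWhittakerDeltaEulerProduct.whittakerDelta_eq_mul_tprod_euler` writes `W_S(f_s)(h) = HEAD_T · ∏'_{v∉T} W°_{S,v}(s)` with ONE head integral over `ν_∞ ⊗ ⨂_{v∈T} ν_v`; ★ B2b FILE 2
isolates a FINITE `v₀ ∈ T` from it; THIS FILE isolates the ARCH SLOT instead: for a head family PURE IN THE ARCH SLOT as a function, `fT s (a, q) = bA s a · rT s q` (e.g.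
`f = stdExtension 𝒦 ½ φ` with `φ` pure at `∞`), ★ B5 §1 `integral_prod_pi_eq_mul_of_pureArch` (Mathlib `integral_prod_mul`, no integrability hypothesis beyond ★ G1's own `hG`) splits
the head:
* §1 **`whittakerDelta_eq_archFactor_mul_of_pureArch`** — ★ G1's letters VERBATIM + `(bA) (rT) (hpure)` ⊢
  `W_S(f_s)(h) = [∫_{N_Δ(L⁺⊗ℝ)} conj ψ_S(a_∞) · bA_s(w_{Δ,∞}·a·h_∞) dν_∞(a)] · ([∫ (∏_{v∈T} conj ψ_S(ι_v q_v)) · rT_s((w_{Δ,v}·q_v·h_v)_{v∈T}) d(⨂_{v∈T} ν_v)] · ∏'_{v∉T} W°_{S,v}(s))`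
  — the ARCH factor is the letter `A∞` of ★ p863937 (its continuation `A∞c` = (K1a-3-arch) ★ p863260 lineage), the bracket is the FINITE rest whose head ★ (F-rest)
  `exists_clearedRest_kernelPlace` clears at `Tw := T`.
Heartbeats: ONE `maxHeartbeats 800000` on the head = ★ G1's ∕ ★ B2b FILE 2's MEASURED class; the proof is `rw [★ G1, ★ B5 §1]` + `exact mul_assoc _ _ _` (as ★ FILE 2).
References: [KudlaRallis1994] S. Kudla, S. Rallis, Ann. of Math. 140 (1994), §2; [Tan1999] V. Tan, Canad. J. Math. 51 (1999), §3 (`W_β = ⊗_v W_{β,v}`);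
[Folland1995] G. Folland, *A Course in Abstract Harmonic Analysis* (1995), §2.2.
HONEST LABEL.  Count-neutral helper: `HC_CM` is proved only modulo the 7 printed citations (2 remaining named inputs: hLiu418 = `stmt-HodgeConjecture-24832`,
h413 = `stmt-HodgeConjecture-24833`) until rung 0 closes; U1-glob LEVEL 2 stays OPEN (FILE B; the arch branch's `hdead∞` and the arch purity of `stdExtension`).
-/

set_option autoImplicit false
set_option linter.dupNamespace false -- the mandated namespace repeats `HodgeConjecture.HodgeConjecture`

noncomputable section

open scoped BigOperators Topology
open MeasureTheory MeasureTheory.Measure Set Filter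
open Summit.HodgeConjecture.HodgeConjecture.Cruxes.HLiu418.K2LiuLocalKernelArchPlaceFactor (integral_prod_pi_eq_mul_of_pureArch)

namespace Summit.HodgeConjecture.HodgeConjecture.Cruxes.HLiu418.K2LiuSingularWhittakerArchFactorEuler

/-! ## §1 ★ G1's Euler head RE-BRACKETED for a head family pure in the arch slot -/

section Euler

open scoped Matrix RestrictedProduct ENNReal NNReal ComplexConjugate
open NumberField IsDedekindDomain
open Literature.NumberTheory.Automorphic Literature.NumberTheory.GaloisRepresentations
open Literature.NumberTheory.GelbartRogawski1991 Literature.NumberTheory.GelbartRogawski1991.GRConstruction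
open Literature.NumberTheory.K2Lit.SiegelDoubled
open Literature.NumberTheory.K2Lit.PlaceSplitting
open Literature.MeasureTheory.RestrictedProduct
open Literature.Topology.Algebra.RestrictedProduct (inH)
open Summit.HodgeConjecture.HodgeConjecture.Cruxes.HLiu418.K2LiuSiegelUnipotentLocalDefs
open Summit.HodgeConjecture.HodgeConjecture.Cruxes.HLiu418.K2LiuSiegelUnipotentSplitDefs
open Summit.HodgeConjecture.HodgeConjecture.Cruxes.HLiu418.K2LiuSiegelUnipotentSplitAtDefs
open Summit.HodgeConjecture.HodgeConjecture.Cruxes.HLiu418.K2LiuSiegelUnipotentFourierDefs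
open Summit.HodgeConjecture.HodgeConjecture.Cruxes.HLiu418.K2LiuWhittakerDeltaEulerProduct (whittakerDelta_eq_mul_tprod_euler)

variable (L : Type) [Field L] [NumberField L] [IsCMField L]
variable {N M n : ℕ} (e : Fin N × Fin M ≃ Fin n)
  (dV : Fin N → L) (hdV : ∀ i, IsCMField.complexConj L (dV i) = dV i)
  (dW : Fin M → L) (hdW : ∀ i, IsCMField.complexConj L (dW i) = dW i)
  (T : Finset (HeightOneSpectrum (𝓞 (Fp L)))) [DecidableEq (HeightOneSpectrum (𝓞 (Fp L)))]
  [MeasurableSpace ↥(unipDelta L e dV hdV dW hdW)] [BorelSpace ↥(unipDelta L e dV hdV dW hdW)]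
  [MeasurableSpace ↥(unipDeltaArch L e dV hdV dW hdW)] [BorelSpace ↥(unipDeltaArch L e dV hdV dW hdW)]
  [∀ v : HeightOneSpectrum (𝓞 (Fp L)), MeasurableSpace ↥(unipDeltaLoc L e dV hdV dW hdW v)] [∀ v : HeightOneSpectrum (𝓞 (Fp L)), BorelSpace ↥(unipDeltaLoc L e dV hdV dW hdW v)]

set_option maxHeartbeats 800000 in -- MEASURED class of ★ G1 ∕ ★ B2b FILE 2 (> 400 000): the adelic doubled unitary datum + the Haar∕Borel tower; `rw` ×2 + `exact mul_assoc`
/-- **★ G1's EULER HEAD WITH THE ARCHIMEDEAN SLOT ISOLATED (the `htail∞` letter of ★ `K2LiuLocalKernelPlacePackageArch`, first link).**  ★ `whittakerDelta_eq_mul_tprod_euler`'s letters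
verbatim, plus: the head family `fT` is PURE IN THE ARCH SLOT as a function — `fT s (a, q) = bA s a · rT s q` (`hpure`; e.g. `f = stdExtension 𝒦 ½ φ` with `φ` pure at `∞`).  THEN on the
convergence half-plane (wherever ★ G1 holds):
`W_S(f_s)(h) = [∫_{N_Δ(L⁺⊗ℝ)} conj ψ_S(a_∞) · bA_s(w_{Δ,∞}·a·h_∞) dν_∞(a)] · ([∫ (∏_{v∈T} conj ψ_S(ι_v q_v)) · rT_s((w_{Δ,v}·q_v·h_v)_{v∈T}) d(⨂_{v∈T} ν_v)] · ∏'_{v∉T} W°_{S,v}(s))`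
— ★ G1 then ★ B5 §1 `integral_prod_pi_eq_mul_of_pureArch` on the head, then `mul_assoc`. [cite: KudlaRallis1994, §2] [cite: Tan1999, §3] [cite: Folland1995, §2.2] -/
theorem whittakerDelta_eq_archFactor_mul_of_pureArch
    (νN : Measure ↥(unipDelta L e dV hdV dW hdW)) (νv : ∀ v : HeightOneSpectrum (𝓞 (Fp L)), Measure ↥(unipDeltaLoc L e dV hdV dW hdW v)) [∀ v, (νv v).IsHaarMeasure]
    [∀ v, SigmaFinite (νv v)]
    (hνK : ∀ v, v ∉ T → νv v (((inH (fun v => UnitaryGroup.localInt L (IsCMField.complexConj L) (n + n) (hermD L e dV hdV dW hdW) v) (fun v => unipDeltaLoc L e dV hdV dW hdW v) v) : Subgroup ↥(unipDeltaLoc L e dV hdV dW hdW v)) : Set ↥(unipDeltaLoc L e dV hdV dW hdW v)) = 1)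
    (νinf : Measure ↥(unipDeltaArch L e dV hdV dW hdW)) [SigmaFinite νinf]
    (hmap : Measure.map (unipDeltaSplitAt L e dV hdV dW hdW T) νN =
      νinf.prod ((Measure.pi fun v : T => νv v.1).prod
        (rpMeasure (fun v : {v : HeightOneSpectrum (𝓞 (Fp L)) // v ∉ T} => ((inH (fun v => UnitaryGroup.localInt L (IsCMField.complexConj L) (n + n) (hermD L e dV hdV dW hdW) v) (fun v => unipDeltaLoc L e dV hdV dW hdW v) v.1 : Subgroup ↥(unipDeltaLoc L e dV hdV dW hdW v.1)) : Set ↥(unipDeltaLoc L e dV hdV dW hdW v.1))) (fun v => νv v.1) ∅)))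
    {χ : HeckeCharacter L} (hχ : ∀ v, v ∉ T → ∀ w' : UnitaryGroup.PlacesOver L v, χ.IsUnramifiedAt w'.1)
    {f : ℂ → HA L e dV hdV dW hdW → ℂ}
    {fT : ℂ → UnitaryGroup.arch (Fp L) L (IsCMField.complexConj L) (n + n) (hermD L e dV hdV dW hdW) ×
      (Π v : T, UnitaryGroup.localPi L (IsCMField.complexConj L) (n + n) (hermD L e dV hdV dW hdW) v.1) → ℂ}
    (hfac : IsFactorizableOff L e dV hdV dW hdW T χ f fT)
    -- purity of the head family IN THE ARCH SLOT
    (bA : ℂ → UnitaryGroup.arch (Fp L) L (IsCMField.complexConj L) (n + n) (hermD L e dV hdV dW hdW) → ℂ)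
    (rT : ℂ → (Π v : T, UnitaryGroup.localPi L (IsCMField.complexConj L) (n + n) (hermD L e dV hdV dW hdW) v.1) → ℂ)
    (hpure : ∀ (s : ℂ) (a : UnitaryGroup.arch (Fp L) L (IsCMField.complexConj L) (n + n) (hermD L e dV hdV dW hdW))
      (q : Π v : T, UnitaryGroup.localPi L (IsCMField.complexConj L) (n + n) (hermD L e dV hdV dW hdW) v.1),
      fT s (a, q) = bA s a * rT s q)
    (s : ℂ) (S : Matrix (Fin n) (Fin n) L) {h : HA L e dV hdV dW hdW}
    (hh : ∀ v, v ∉ T → UnitaryGroup.evalPlace (Fp L) L (IsCMField.complexConj L) (n + n) (hermD L e dV hdV dW hdW) v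
      (UnitaryGroup.finPart (Fp L) L (IsCMField.complexConj L) (n + n) (hermD L e dV hdV dW hdW) h) ∈
        UnitaryGroup.localInt L (IsCMField.complexConj L) (n + n) (hermD L e dV hdV dW hdW) v)
    (hw : ∀ v, v ∉ T → UnitaryGroup.evalPlace (Fp L) L (IsCMField.complexConj L) (n + n) (hermD L e dV hdV dW hdW) v
      (UnitaryGroup.finPart (Fp L) L (IsCMField.complexConj L) (n + n) (hermD L e dV hdV dW hdW) (weylDelta L e dV hdV dW hdW)) ∈
        UnitaryGroup.localInt L (IsCMField.complexConj L) (n + n) (hermD L e dV hdV dW hdW) v)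
    (hS : ∀ v, v ∉ T → ∀ (w : UnitaryGroup.PlacesOver L v) (i j : Fin n), ((S i j : L) : w.1.adicCompletion L) ∈ w.1.adicCompletionIntegers L)
    (hG : Integrable (fun u : ↥(unipDelta L e dV hdV dW hdW) =>
      conj (unipDeltaChar L e dV hdV dW hdW S (u : HA L e dV hdV dW hdW) : ℂ) * f s (weylDelta L e dV hdV dW hdW * (u : HA L e dV hdV dW hdW) * h)) νN) :
    whittakerDelta L e dV hdV dW hdW νN S (f s) h =
      (∫ a, conj (unipDeltaChar L e dV hdV dW hdW S
            (UnitaryGroup.archToAdelic (Fp L) L (IsCMField.complexConj L) (n + n) (hermD L e dV hdV dW hdW)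
              (a : UnitaryGroup.arch (Fp L) L (IsCMField.complexConj L) (n + n) (hermD L e dV hdV dW hdW))) : ℂ) *
          bA s (UnitaryGroup.archPart (Fp L) L (IsCMField.complexConj L) (n + n) (hermD L e dV hdV dW hdW) (weylDelta L e dV hdV dW hdW) *
                (a : UnitaryGroup.arch (Fp L) L (IsCMField.complexConj L) (n + n) (hermD L e dV hdV dW hdW)) *
                UnitaryGroup.archPart (Fp L) L (IsCMField.complexConj L) (n + n) (hermD L e dV hdV dW hdW) h) ∂νinf) *
      ((∫ q, (∏ v : T, conj (unipDeltaChar L e dV hdV dW hdW S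
              (locToAdelic L e dV hdV dW hdW v.1
                ((q v : ↥(unipDeltaLoc L e dV hdV dW hdW v.1)) : UnitaryGroup.localPi L (IsCMField.complexConj L) (n + n) (hermD L e dV hdV dW hdW) v.1)) : ℂ)) *
          rT s (fun v : T => UnitaryGroup.evalPlace (Fp L) L (IsCMField.complexConj L) (n + n) (hermD L e dV hdV dW hdW) v.1
                  (UnitaryGroup.finPart (Fp L) L (IsCMField.complexConj L) (n + n) (hermD L e dV hdV dW hdW) (weylDelta L e dV hdV dW hdW)) *
                ((q v : ↥(unipDeltaLoc L e dV hdV dW hdW v.1)) : UnitaryGroup.localPi L (IsCMField.complexConj L) (n + n) (hermD L e dV hdV dW hdW) v.1) *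
                UnitaryGroup.evalPlace (Fp L) L (IsCMField.complexConj L) (n + n) (hermD L e dV hdV dW hdW) v.1
                  (UnitaryGroup.finPart (Fp L) L (IsCMField.complexConj L) (n + n) (hermD L e dV hdV dW hdW) h))
          ∂(Measure.pi fun v : T => νv v.1)) *
        ∏' v : {v : HeightOneSpectrum (𝓞 (Fp L)) // v ∉ T},
          ∫ y, conj (unipDeltaChar L e dV hdV dW hdW S
              (locToAdelic L e dV hdV dW hdW v.1 (y : UnitaryGroup.localPi L (IsCMField.complexConj L) (n + n) (hermD L e dV hdV dW hdW) v.1)) : ℂ) *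
            LambdaLoc L e dV hdV dW hdW v.1 χ s
              (UnitaryGroup.evalPlace (Fp L) L (IsCMField.complexConj L) (n + n) (hermD L e dV hdV dW hdW) v.1
                  (UnitaryGroup.finPart (Fp L) L (IsCMField.complexConj L) (n + n) (hermD L e dV hdV dW hdW) (weylDelta L e dV hdV dW hdW)) *
                (y : UnitaryGroup.localPi L (IsCMField.complexConj L) (n + n) (hermD L e dV hdV dW hdW) v.1)) ∂(νv v.1)) := by
  rw [(whittakerDelta_eq_mul_tprod_euler L e dV hdV dW hdW T νN νv hνK νinf hmap hχ hfac s S hh hw hS hG).2,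
    integral_prod_pi_eq_mul_of_pureArch (fun v : T => νv v.1) νinf
      (fun a : ↥(unipDeltaArch L e dV hdV dW hdW) => conj (unipDeltaChar L e dV hdV dW hdW S
        (UnitaryGroup.archToAdelic (Fp L) L (IsCMField.complexConj L) (n + n) (hermD L e dV hdV dW hdW)
          (a : UnitaryGroup.arch (Fp L) L (IsCMField.complexConj L) (n + n) (hermD L e dV hdV dW hdW))) : ℂ))
      (fun (v : T) (y : ↥(unipDeltaLoc L e dV hdV dW hdW v.1)) => conj (unipDeltaChar L e dV hdV dW hdW S
        (locToAdelic L e dV hdV dW hdW v.1 (y : UnitaryGroup.localPi L (IsCMField.complexConj L) (n + n) (hermD L e dV hdV dW hdW) v.1)) : ℂ))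
      (fun z => fT s (UnitaryGroup.archPart (Fp L) L (IsCMField.complexConj L) (n + n) (hermD L e dV hdV dW hdW) (weylDelta L e dV hdV dW hdW) *
            (z.1 : UnitaryGroup.arch (Fp L) L (IsCMField.complexConj L) (n + n) (hermD L e dV hdV dW hdW)) *
            UnitaryGroup.archPart (Fp L) L (IsCMField.complexConj L) (n + n) (hermD L e dV hdV dW hdW) h,
          fun v : T => UnitaryGroup.evalPlace (Fp L) L (IsCMField.complexConj L) (n + n) (hermD L e dV hdV dW hdW) v.1
              (UnitaryGroup.finPart (Fp L) L (IsCMField.complexConj L) (n + n) (hermD L e dV hdV dW hdW) (weylDelta L e dV hdV dW hdW)) *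
            ((z.2 v : ↥(unipDeltaLoc L e dV hdV dW hdW v.1)) : UnitaryGroup.localPi L (IsCMField.complexConj L) (n + n) (hermD L e dV hdV dW hdW) v.1) *
            UnitaryGroup.evalPlace (Fp L) L (IsCMField.complexConj L) (n + n) (hermD L e dV hdV dW hdW) v.1
              (UnitaryGroup.finPart (Fp L) L (IsCMField.complexConj L) (n + n) (hermD L e dV hdV dW hdW) h)))
      (fun a : ↥(unipDeltaArch L e dV hdV dW hdW) =>
        bA s (UnitaryGroup.archPart (Fp L) L (IsCMField.complexConj L) (n + n) (hermD L e dV hdV dW hdW) (weylDelta L e dV hdV dW hdW) *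
            (a : UnitaryGroup.arch (Fp L) L (IsCMField.complexConj L) (n + n) (hermD L e dV hdV dW hdW)) *
            UnitaryGroup.archPart (Fp L) L (IsCMField.complexConj L) (n + n) (hermD L e dV hdV dW hdW) h))
      (fun q : (Π v : T, ↥(unipDeltaLoc L e dV hdV dW hdW v.1)) =>
        rT s (fun v : T => UnitaryGroup.evalPlace (Fp L) L (IsCMField.complexConj L) (n + n) (hermD L e dV hdV dW hdW) v.1
              (UnitaryGroup.finPart (Fp L) L (IsCMField.complexConj L) (n + n) (hermD L e dV hdV dW hdW) (weylDelta L e dV hdV dW hdW)) *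
            ((q v : ↥(unipDeltaLoc L e dV hdV dW hdW v.1)) : UnitaryGroup.localPi L (IsCMField.complexConj L) (n + n) (hermD L e dV hdV dW hdW) v.1) *
            UnitaryGroup.evalPlace (Fp L) L (IsCMField.complexConj L) (n + n) (hermD L e dV hdV dW hdW) v.1
              (UnitaryGroup.finPart (Fp L) L (IsCMField.complexConj L) (n + n) (hermD L e dV hdV dW hdW) h)))
      (fun a q => hpure s _ _)]
  exact mul_assoc _ _ _

end Euler

end Summit.HodgeConjecture.HodgeConjecture.Cruxes.HLiu418.K2LiuSingularWhittakerArchFactorEuler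

end
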